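import Literature.NumberTheory.Automorphic.CartanDecompositionGLnPowers
import Literature.NumberTheory.Automorphic.GLnCongruenceSubgroups
import Literature.NumberTheory.Automorphic.HilbertRepSpectrum
import HarnessLib

/-!
# Matrix coefficients of vectors of cuspidal type vanish off `ϖ^ℤ · GL_n(𝒪)`
(Bushnell–Kutzko, *The admissible dual of `GL(N)` via compact open subgroups* (1993), (5.5.7),
(6.2.1)–(6.2.3): the intertwining of a cuspidal type of level zero is `F^× GL_n(𝒪)`; Carayol,
*Représentations cuspidales du groupe linéaire*, Ann. Sci. ÉNS 17 (1984), §4; for `GL_2`: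
Bushnell–Henniart, *The local Langlands conjecture for `GL(2)`* (2006), 11.1–11.5, 15.3; the
mechanism in Gelbart, *Automorphic forms on adele groups* (1975), §10, pp. 151–153, where the
minimal idempotent `ξ_S` of a supercuspidal type cuts the slice `M = R(ξ_S) L²₀` on which the
complementary group acts)

Topic `NumberTheory/Automorphic`; theorems only (no definition, no named fact, no instance). Part
of the inline (D-0026) decomposition of the named fact
`Literature.NumberTheory.Automorphic.multiplicity_one_quaternionUnits K D` (`JacquetLanglandsParts`,
Gelbart Thm. 10.10), types route (`QuaternionUnitsMultiplicityOneOfTypeComparison`,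
`HilbertRepSliceDecompositionMultiplicityFree`, `CuspidalSliceStrongMultiplicityOne`): the
remaining representation-theoretic input there is that the slice of a cuspidal constituent cut
out by a **cuspidal type** `λ` of `K₀ = GL_n(𝒪_v)` (an irreducible representation trivial on
`K₁ = 1 + M_n(𝔭_v)` whose restriction to every block-unipotent subgroup `N_m(𝔽_q)` contains no
invariant vector) is irreducible for the complementary group, i.e. that the compressed operators
`E R(g) E`, `g ∈ GL_n(K_v)`, act on it by scalars. This file proves the local statement behind
it, for an arbitrary unitary representation `τ` of `GL_n(F)` (`F` a discretely valued field with
uniformizing element `ϖ`, `𝒪 = 𝒪[F]`, `K₀ = glInt n F`):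

* `exists_jump_of_antitone_of_ne` — an antitone `a : Fin n → ℤ` which is not constant has a jump
  `a_{m-1} > a_m` at some `0 < m < n`.
* `conj_blockUnipotent_mem_glInt`, `valuation_conj_blockUnipotent_sub_one_lt_one` — for
  `d = diag(ϖ^{a_i})` with `a` antitone jumping at `m` and `u = 1 + Y` with `Y` integral and
  supported in the block `{(i, j) : i < m ≤ j}`, the conjugate `d u d⁻¹` lies in `K₀` and is
  `≡ 1 mod 𝔭` (its off-block entries vanish and its block entries are `ϖ^{a_i - a_j} Y_{ij}`,
  `a_i - a_j ≥ 1`; `coe_zpowDiagGL_mul_mul_inv_sub_one_apply` of `GLnCongruenceSubgroups`).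
* `inner_map_eq_zero_of_cuspidalType` — **main theorem**: let `X ⊆ H` be a set of vectors stable
  under `τ(K₀)`, fixed by every `k ∈ K₀` with `k ≡ 1 mod 𝔭`, and killed, for each `0 < m < n`, by
  `Σ_{r ∈ R_m} τ(r)` for some non-empty finite set `R_m` of integral block-unipotent elements
  `1 + Y` of the block `m` (for the `λ`-isotypic vectors of a cuspidal type: `R_m` a set of
  representatives of `N_m(𝒪) / N_m(𝔭)`, on which `Σ λ(r) = 0` by cuspidality). Then
  **`⟪τ(g) x, y⟫ = 0` for all `x, y ∈ X` unless `g ∈ ϖ^ℤ · K₀`**. Proof: Cartan decomposition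
  `g = k₁⁻¹ ϖ^a k₂⁻¹` (`exists_glInt_mul_mul_eq_zpowDiagGL`); if `a` is constant, `g ∈ ϖ^c K₀`;
  otherwise `a` jumps at some `m`, and for `x' = τ(k₂⁻¹) x`, `y' = τ(k₁) y ∈ X` and `r ∈ R_m`,
  `y'` is fixed by `ϖ^a r ϖ^{-a} ≡ 1 mod 𝔭`, so `⟪τ(ϖ^a) x', y'⟫ = ⟪τ(ϖ^a) τ(r) x', y'⟫`; summing
  over `r ∈ R_m` gives `|R_m| ⟪τ(ϖ^a) x', y'⟫ = ⟪τ(ϖ^a) Σ_r τ(r) x', y'⟫ = 0`.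

Consequence (not restated here): for the minimal idempotent `E` of a cuspidal type
(`ContRepresentation.exists_minimalIdempotent`, whose range consists of such vectors)
`E τ(g) E = 0` for `g ∉ ϖ^ℤ K₀`, while `E τ(ϖ^c k) E = τ(ϖ^c · 1) c(k) E` with `τ(ϖ^c · 1)`
central — the per-constituent scalars needed for the irreducibility of slices
(`ClosedSubrep.slice_eq_bot_or_eq`, `HilbertRepIdempotentSlice`).

## References

* C. J. Bushnell, P. C. Kutzko, *The admissible dual of `GL(N)` via compact open subgroups*,
  Ann. of Math. Studies 129 (1993), (5.5.7), §6.2 [BushnellKutzko1993].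
* C. J. Bushnell, G. Henniart, *The local Langlands conjecture for `GL(2)`*, Grundlehren 335
  (2006), §11, 15.3 [BushnellHenniart2006].
* S. Gelbart, *Automorphic forms on adele groups*, Ann. of Math. Studies 83 (1975), §10,
  pp. 151–153 [Gelbart1975].
* P. Cartier, *Representations of 𝔭-adic groups: a survey*, Proc. Sympos. Pure Math. 33 (1979),
  part 1, §IV.2 [CartierCorvallis1979].
-/

noncomputable section

open scoped InnerProductSpace MatrixGroups
open ValuativeRel Matrix

namespace Literature.NumberTheory.Automorphic

section CuspidalType

variable {F : Type*} [Field F] [ValuativeRel F] {n : ℕ}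

/-! ### Jumps of antitone exponent vectors -/

omit [ValuativeRel F] in
/-- An antitone integer vector on `Fin n` which is not constant has a jump `a_{m-1} > a_m` at
some `0 < m < n`. [folklore] -/
theorem exists_jump_of_antitone_of_ne {a : Fin n → ℤ} (ha : Antitone a)
    (hne : ¬ ∃ c : ℤ, a = fun _ => c) :
    ∃ (m : ℕ) (hm0 : 0 < m) (hmn : m < n), a ⟨m, hmn⟩ < a ⟨m - 1, by omega⟩ := by
  classical
  rcases Nat.eq_zero_or_pos n with hn | hn
  · subst hn
    exact absurd ⟨0, funext fun i => i.elim0⟩ hne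
  set c : ℤ := a ⟨0, hn⟩ with hc
  have hex : ∃ m : ℕ, ∃ hm : m < n, a ⟨m, hm⟩ ≠ c := by
    by_contra hall
    push Not at hall
    exact hne ⟨c, funext fun i => hall i i.2⟩
  let m := Nat.find hex
  obtain ⟨hmn, hmc⟩ : ∃ hm : m < n, a ⟨m, hm⟩ ≠ c := Nat.find_spec hex
  have hm0 : 0 < m := by
    rcases Nat.eq_zero_or_pos m with h0 | h0
    · exfalso
      apply hmc
      have : (⟨m, hmn⟩ : Fin n) = ⟨0, hn⟩ := Fin.ext h0
      rw [this]
    · exact h0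
  have hprev : a ⟨m - 1, by omega⟩ = c := by
    by_contra hne'
    have hmin := Nat.find_min hex (m := m - 1) (by omega)
    exact hmin ⟨by omega, hne'⟩
  refine ⟨m, hm0, hmn, ?_⟩
  have hle : a ⟨m, hmn⟩ ≤ a ⟨m - 1, by omega⟩ :=
    ha (Fin.mk_le_mk.2 (Nat.sub_le m 1))
  rw [hprev] at hle ⊢
  exact lt_of_le_of_ne hle hmc

/-! ### Conjugating block-unipotent elements by dominant diagonal elements -/

variable {ϖ : F}

/-- For `d = diag(ϖ^{a_i})` with `a` antitone and `a_{m-1} > a_m`, and `u = 1 + Y` with `Y`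
integral and supported in the block `{(i, j) : i < m ≤ j}`, every entry of `d u d⁻¹ - 1` has
valuation `< 1` (`d u d⁻¹ ≡ 1 mod 𝔭`). [cite: BushnellKutzko1993, (5.5.7)] -/
theorem valuation_conj_blockUnipotent_sub_one_lt_one (hϖ : IsUniformizingElement ϖ)
    {a : Fin n → ℤ} (ha : Antitone a) {m : ℕ} (hm0 : 0 < m) (hmn : m < n)
    (hjump : a ⟨m, hmn⟩ < a ⟨m - 1, by omega⟩)
    (u : GL (Fin n) F) (Y : Matrix (Fin n) (Fin n) F) (hY : ∀ i j, Y i j ∈ 𝒪[F])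
    (hY0 : ∀ i j : Fin n, ¬ ((i : ℕ) < m ∧ m ≤ (j : ℕ)) → Y i j = 0)
    (hu : ((u : GL (Fin n) F) : Matrix (Fin n) (Fin n) F) = 1 + Y) (i j : Fin n) :
    valuation F ((((zpowDiagGL hϖ.ne_zero a * u * (zpowDiagGL hϖ.ne_zero a)⁻¹ : GL (Fin n) F) :
        Matrix (Fin n) (Fin n) F) - 1) i j) < 1 := by
  rw [coe_zpowDiagGL_mul_mul_inv_sub_one_apply hϖ.ne_zero a u i j, hu, add_sub_cancel_left]
  by_cases hb : (i : ℕ) < m ∧ m ≤ (j : ℕ)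
  · -- in the block: the exponent `a i - a j ≥ 1`
    have hi : a ⟨m - 1, by omega⟩ ≤ a i := ha (Fin.mk_le_mk.2 (by omega) : i ≤ ⟨m - 1, _⟩)
    have hj : a j ≤ a ⟨m, hmn⟩ := ha (Fin.mk_le_mk.2 hb.2 : (⟨m, hmn⟩ : Fin n) ≤ j)
    have he : 1 ≤ a i - a j := by omega
    obtain ⟨e, he'⟩ : ∃ e : ℕ, a i - a j = (e : ℤ) + 1 := ⟨(a i - a j - 1).toNat, by omega⟩
    rw [he', zpow_add₀ hϖ.ne_zero, zpow_one, zpow_natCast, map_mul, map_mul, map_pow]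
    have h1 : valuation F ϖ ^ e ≤ 1 := pow_le_one' hϖ.valuation_lt_one.le e
    have h2 : valuation F (Y i j) ≤ 1 := (Valuation.mem_integer_iff _ _).1 (hY i j)
    calc valuation F ϖ ^ e * valuation F ϖ * valuation F (Y i j)
        ≤ 1 * valuation F ϖ * 1 := by gcongr
      _ = valuation F ϖ := by rw [one_mul, mul_one]
      _ < 1 := hϖ.valuation_lt_one
  · rw [hY0 i j hb, mul_zero, map_zero]
    exact zero_lt_one

/-- With the same data, `d u d⁻¹ ∈ GL_n(𝒪)`: its entries are integral and its determinant is
`det u = det (1 + Y) = 1` (`Y` is strictly upper triangular). [cite: BushnellKutzko1993, (5.5.7)] -/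
theorem conj_blockUnipotent_mem_glInt (hϖ : IsUniformizingElement ϖ)
    {a : Fin n → ℤ} (ha : Antitone a) {m : ℕ} (hm0 : 0 < m) (hmn : m < n)
    (hjump : a ⟨m, hmn⟩ < a ⟨m - 1, by omega⟩)
    (u : GL (Fin n) F) (Y : Matrix (Fin n) (Fin n) F) (hY : ∀ i j, Y i j ∈ 𝒪[F])
    (hY0 : ∀ i j : Fin n, ¬ ((i : ℕ) < m ∧ m ≤ (j : ℕ)) → Y i j = 0)
    (hu : ((u : GL (Fin n) F) : Matrix (Fin n) (Fin n) F) = 1 + Y) :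
    zpowDiagGL hϖ.ne_zero a * u * (zpowDiagGL hϖ.ne_zero a)⁻¹ ∈ glInt n F := by
  set c := zpowDiagGL hϖ.ne_zero a * u * (zpowDiagGL hϖ.ne_zero a)⁻¹ with hc
  refine mem_glInt_of_isIntegralMatrix (fun i j => ?_) ?_
  · -- entries: `c i j = (c - 1) i j + 1 i j`
    have h := valuation_conj_blockUnipotent_sub_one_lt_one hϖ ha hm0 hmn hjump u Y hY hY0 hu i j
    have heq : ((c : GL (Fin n) F) : Matrix (Fin n) (Fin n) F) i j =
        (((c : GL (Fin n) F) : Matrix (Fin n) (Fin n) F) - 1) i j +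
          (1 : Matrix (Fin n) (Fin n) F) i j := by
      rw [Matrix.sub_apply, sub_add_cancel]
    rw [heq]
    refine Subring.add_mem _ ((Valuation.mem_integer_iff _ _).2 h.le) (IsIntegralMatrix.one i j)
  · -- determinant
    have hdetY : (1 + Y).det = 1 := by
      have htri : (1 + Y).BlockTriangular id := by
        intro i j hij
        change j < i at hij
        rw [Matrix.add_apply, Matrix.one_apply, if_neg (ne_of_gt hij), zero_add]
        refine hY0 i j fun hb => ?_
        have : (j : ℕ) < (i : ℕ) := hij
        omega
      rw [Matrix.det_of_upperTriangular htri]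
      refine Finset.prod_eq_one fun i _ => ?_
      rw [Matrix.add_apply, Matrix.one_apply, if_pos rfl, hY0 i i fun hb => by omega, add_zero]
    have hdet : ((c : GL (Fin n) F) : Matrix (Fin n) (Fin n) F).det = 1 := by
      rw [hc, Units.val_mul, Units.val_mul, hu, Matrix.det_mul, Matrix.det_mul, hdetY, mul_one,
        ← Matrix.det_mul, ← Units.val_mul, mul_inv_cancel, Units.val_one, Matrix.det_one]
    rw [hdet, map_one]

/-! ### The vanishing of matrix coefficients off `ϖ^ℤ GL_n(𝒪)` -/

variable [IsDiscreteValuationRing 𝒪[F]]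
  {H : Type*} [NormedAddCommGroup H] [InnerProductSpace ℂ H] [CompleteSpace H]

/-- **Matrix coefficients of vectors of cuspidal type vanish off `ϖ^ℤ · GL_n(𝒪)`.** Let `τ` be a
unitary representation of `GL_n(F)` on `H` and `X ⊆ H` a set of vectors which is stable under
`τ(K₀)`, `K₀ = GL_n(𝒪)`, pointwise fixed by every `k ∈ K₀` with `k ≡ 1 mod 𝔭`, and such that for
each `0 < m < n` there is a non-empty finite set `R_m` of integral block-unipotent elements
`1 + Y` (`Y` integral, supported in `{(i, j) : i < m ≤ j}`) with `Σ_{r ∈ R_m} τ(r) x = 0` for all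
`x ∈ X` (cuspidality of the type). If `g ∈ GL_n(F)` is not of the form `ϖ^c k`, `c ∈ ℤ`,
`k ∈ K₀`, then `⟪τ(g) x, y⟫ = 0` for all `x, y ∈ X`. [cite: BushnellKutzko1993, (5.5.7) and
§6.2; BushnellHenniart2006, 11.1] -/
theorem inner_map_eq_zero_of_cuspidalType (hϖ : IsUniformizingElement ϖ)
    {τ : ContRepresentation ℂ (GL (Fin n) F) H} (hτ : τ.IsUnitary)
    (X : Set H) (hXK : ∀ k ∈ glInt n F, ∀ x ∈ X, τ k x ∈ X)
    (hX₁ : ∀ k ∈ glInt n F,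
      (∀ i j, valuation F ((((k : GL (Fin n) F) : Matrix (Fin n) (Fin n) F) - 1) i j) < 1) →
      ∀ x ∈ X, τ k x = x)
    (hXcusp : ∀ m : ℕ, 0 < m → m < n →
      ∃ R : Finset (GL (Fin n) F), R.Nonempty ∧
        (∀ r ∈ R, ∃ Y : Matrix (Fin n) (Fin n) F, (∀ i j, Y i j ∈ 𝒪[F]) ∧
          (∀ i j : Fin n, ¬ ((i : ℕ) < m ∧ m ≤ (j : ℕ)) → Y i j = 0) ∧
          ((r : GL (Fin n) F) : Matrix (Fin n) (Fin n) F) = 1 + Y) ∧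
        ∀ x ∈ X, ∑ r ∈ R, τ r x = 0)
    {g : GL (Fin n) F}
    (hg : ∀ (c : ℤ), ∀ k ∈ glInt n F, g ≠ zpowDiagGL hϖ.ne_zero (fun _ => c) * k)
    {x y : H} (hx : x ∈ X) (hy : y ∈ X) : ⟪τ g x, y⟫_ℂ = 0 := by
  classical
  -- Cartan decomposition `k₁ g k₂ = ϖ^a`
  obtain ⟨k₁, hk₁, k₂, hk₂, a, ha, hgd⟩ := exists_glInt_mul_mul_eq_zpowDiagGL hϖ g
  set d : GL (Fin n) F := zpowDiagGL hϖ.ne_zero a with hd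
  have hg' : g = k₁⁻¹ * d * k₂⁻¹ := by rw [← hgd]; group
  -- `a` is not constant
  have hne : ¬ ∃ c : ℤ, a = fun _ => c := by
    rintro ⟨c, rfl⟩
    refine hg c (k₁⁻¹ * k₂⁻¹) (Subgroup.mul_mem _ (Subgroup.inv_mem _ hk₁) (Subgroup.inv_mem _ hk₂))
      ?_
    rw [hg', hd, ← mul_assoc, mul_zpowDiagGL_const_comm hϖ.ne_zero c k₁⁻¹]
  obtain ⟨m, hm0, hmn, hjump⟩ := exists_jump_of_antitone_of_ne ha hne
  obtain ⟨R, hRne, hRform, hRsum⟩ := hXcusp m hm0 hmn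
  -- `τ` is multiplicative
  have hmul : ∀ (g h : GL (Fin n) F) (v : H), τ (g * h) v = τ g (τ h v) := fun g h v => by
    rw [map_mul]; rfl
  have hone : ∀ v : H, τ 1 v = v := fun v => by rw [map_one]; rfl
  -- reduce to `⟪τ d x', y'⟫` with `x' = τ k₂⁻¹ x`, `y' = τ k₁ y`
  set x' : H := τ k₂⁻¹ x with hx'
  set y' : H := τ k₁ y with hy'
  have hx'X : x' ∈ X := hXK _ (Subgroup.inv_mem _ hk₂) x hx
  have hy'X : y' ∈ X := hXK _ hk₁ y hy
  have hred : ⟪τ g x, y⟫_ℂ = ⟪τ d x', y'⟫_ℂ := by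
    have h1 : τ g x = τ k₁⁻¹ (τ d x') := by rw [hg', hmul, hmul]
    rw [h1, ← hτ.inner_map_map k₁, ← hmul, mul_inv_cancel, hone]
  rw [hred]
  -- each `r ∈ R` gives `⟪τ d x', y'⟫ = ⟪τ d (τ r x'), y'⟫`
  have hkey : ∀ r ∈ R, ⟪τ d x', y'⟫_ℂ = ⟪τ d (τ r x'), y'⟫_ℂ := by
    intro r hr
    obtain ⟨Y, hY, hY0, hu⟩ := hRform r hr
    set cr : GL (Fin n) F := d * r * d⁻¹ with hcr
    have hcrK : cr ∈ glInt n F :=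
      conj_blockUnipotent_mem_glInt hϖ ha hm0 hmn hjump r Y hY hY0 hu
    have hcr1 : ∀ i j, valuation F ((((cr : GL (Fin n) F) : Matrix (Fin n) (Fin n) F) - 1) i j) < 1 :=
      valuation_conj_blockUnipotent_sub_one_lt_one hϖ ha hm0 hmn hjump r Y hY hY0 hu
    have hfix : τ cr y' = y' := hX₁ cr hcrK hcr1 y' hy'X
    have hfix' : τ cr⁻¹ y' = y' := by
      conv_lhs => rw [← hfix]
      rw [← hmul, inv_mul_cancel, hone]
    calc ⟪τ d x', y'⟫_ℂ = ⟪τ d x', τ cr⁻¹ y'⟫_ℂ := by rw [hfix']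
      _ = ⟪τ cr (τ d x'), τ cr (τ cr⁻¹ y')⟫_ℂ := (hτ.inner_map_map cr _ _).symm
      _ = ⟪τ (cr * d) x', y'⟫_ℂ := by rw [← hmul, ← hmul cr cr⁻¹, mul_inv_cancel, hone]
      _ = ⟪τ d (τ r x'), y'⟫_ℂ := by rw [hcr, inv_mul_cancel_right, hmul]
  -- sum over `r ∈ R`
  have hsum : (R.card : ℂ) * ⟪τ d x', y'⟫_ℂ = 0 := by
    calc (R.card : ℂ) * ⟪τ d x', y'⟫_ℂ = ∑ r ∈ R, ⟪τ d x', y'⟫_ℂ := by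
          rw [Finset.sum_const, nsmul_eq_mul]
      _ = ∑ r ∈ R, ⟪τ d (τ r x'), y'⟫_ℂ := Finset.sum_congr rfl hkey
      _ = ⟪τ d (∑ r ∈ R, τ r x'), y'⟫_ℂ := by rw [map_sum, sum_inner]
      _ = 0 := by rw [hRsum x' hx'X, map_zero, inner_zero_left]
  have hcard : (R.card : ℂ) ≠ 0 := Nat.cast_ne_zero.2 (Finset.card_pos.2 hRne).ne'
  exact (mul_eq_zero.1 hsum).resolve_left hcard

/-- **The compressions `E τ(g) E` of a cuspidal-type idempotent vanish off `ϖ^ℤ · GL_n(𝒪)` and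
are central multiples of `E` on it.** Let `τ` be a unitary representation of a group `Γ`
receiving `GL_n(F)` through `ι`, `X ⊆ H` a set of vectors of cuspidal type for `τ ∘ ι` (as in
`inner_map_eq_zero_of_cuspidalType`), and `E` a self-adjoint idempotent with range in `X`,
commuting with every operator commuting with `τ(ι K₀)` and satisfying `E τ(ι k) E = c(k) E` for
`k ∈ K₀` (the minimal idempotent of the type, `ContRepresentation.exists_minimalIdempotent`). Then
for every `g ∈ GL_n(F)`: either `E τ(ι g) E = 0`, or `g = ϖ^a k` with `a ∈ ℤ`, `k ∈ K₀`, and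
`E τ(ι g) E = c(k) τ(ι (ϖ^a · 1)) E` — a multiple of `E` by the central element `ϖ^a · 1`. On an
irreducible constituent, where the centre acts by scalars, `E τ(ι g) E` is therefore a scalar
multiple of `E` for every `g` (the per-constituent minimality feeding
`ClosedSubrep.slice_eq_bot_or_eq`). [cite: BushnellKutzko1993, (5.5.7) and §6.2;
Gelbart1975, §10, pp. 151–153] -/
theorem comp_map_comp_eq_of_cuspidalType (hϖ : IsUniformizingElement ϖ)
    {Γ : Type*} [Group Γ] (ι : GL (Fin n) F →* Γ)
    {τ : ContRepresentation ℂ Γ H} (hτ : τ.IsUnitary)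
    (X : Set H) (hXK : ∀ k ∈ glInt n F, ∀ x ∈ X, τ (ι k) x ∈ X)
    (hX₁ : ∀ k ∈ glInt n F,
      (∀ i j, valuation F ((((k : GL (Fin n) F) : Matrix (Fin n) (Fin n) F) - 1) i j) < 1) →
      ∀ x ∈ X, τ (ι k) x = x)
    (hXcusp : ∀ m : ℕ, 0 < m → m < n →
      ∃ R : Finset (GL (Fin n) F), R.Nonempty ∧
        (∀ r ∈ R, ∃ Y : Matrix (Fin n) (Fin n) F, (∀ i j, Y i j ∈ 𝒪[F]) ∧
          (∀ i j : Fin n, ¬ ((i : ℕ) < m ∧ m ≤ (j : ℕ)) → Y i j = 0) ∧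
          ((r : GL (Fin n) F) : Matrix (Fin n) (Fin n) F) = 1 + Y) ∧
        ∀ x ∈ X, ∑ r ∈ R, τ (ι r) x = 0)
    (E : H →L[ℂ] H) (hEsa : ∀ u v : H, ⟪E u, v⟫_ℂ = ⟪u, E v⟫_ℂ) (hEidem : ∀ u, E (E u) = E u)
    (hEX : ∀ u, E u ∈ X)
    (hET : ∀ U : H →L[ℂ] H, (∀ k ∈ glInt n F, U ∘L τ (ι k) = τ (ι k) ∘L U) → U ∘L E = E ∘L U)
    (c : GL (Fin n) F → ℂ) (hEK : ∀ k ∈ glInt n F, E ∘L τ (ι k) ∘L E = c k • E)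
    (g : GL (Fin n) F) :
    E ∘L τ (ι g) ∘L E = 0 ∨
      ∃ (a : ℤ) (k : GL (Fin n) F), k ∈ glInt n F ∧
        g = zpowDiagGL hϖ.ne_zero (fun _ => a) * k ∧
        E ∘L τ (ι g) ∘L E = c k • (τ (ι (zpowDiagGL hϖ.ne_zero fun _ => a)) ∘L E) := by
  by_cases hg : ∃ (a : ℤ) (k : GL (Fin n) F), k ∈ glInt n F ∧
      g = zpowDiagGL hϖ.ne_zero (fun _ => a) * k
  · right
    obtain ⟨a, k, hk, rfl⟩ := hg
    refine ⟨a, k, hk, rfl, ?_⟩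
    set z : GL (Fin n) F := zpowDiagGL hϖ.ne_zero fun _ => a with hz
    -- `τ(ι z)` commutes with `τ(ι K₀)`, hence with `E`
    have hzE : τ (ι z) ∘L E = E ∘L τ (ι z) := by
      refine hET (τ (ι z)) fun k' _ => ?_
      rw [← ContinuousLinearMap.mul_def, ← ContinuousLinearMap.mul_def, ← map_mul, ← map_mul,
        ← map_mul, ← map_mul, hz, mul_zpowDiagGL_const_comm hϖ.ne_zero a k']
    apply ContinuousLinearMap.ext
    intro u
    have h1 := DFunLike.congr_fun hzE (τ (ι k) (E u))
    have h2 := DFunLike.congr_fun (hEK k hk) u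
    simp only [ContinuousLinearMap.coe_comp, Function.comp_apply, FunLike.coe_smul,
      Pi.smul_apply] at h1 h2 ⊢
    have hmul : τ (ι (z * k)) (E u) = τ (ι z) (τ (ι k) (E u)) := by rw [map_mul, map_mul]; rfl
    rw [hmul, ← h1, h2, map_smul]
  · left
    push Not at hg
    have hτι : (τ.restrict ι).IsUnitary := fun g => hτ (ι g)
    have hvan : ∀ x ∈ X, ∀ y ∈ X, ⟪τ (ι g) x, y⟫_ℂ = 0 := fun x hx y hy =>
      inner_map_eq_zero_of_cuspidalType (τ := τ.restrict ι) hϖ hτι X hXK hX₁ hXcusp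
        (fun a k hk h => hg a k hk h) hx hy
    apply ContinuousLinearMap.ext
    intro u
    change E (τ (ι g) (E u)) = 0
    rw [← @inner_self_eq_zero ℂ, ← hEsa, hEidem, ← inner_conj_symm,
      hvan (E u) (hEX u) (E (τ (ι g) (E u))) (hEX _), map_zero]

end CuspidalType

end Literature.NumberTheory.Automorphic
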